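import Summits.QuantumFields.YangMills.Theorems.ParabolicTrajectoryLatticeGapOnTrajectoryStepScalingFreeAnchor
import Summits.QuantumFields.YangMills.Theorems.ParabolicTrajectoryLatticeGapOnTrajectoryTransferSymZeroCoupling
import Summits.QuantumFields.YangMills.Theorems.ParabolicTrajectoryLatticeGapOnTrajectoryStubNegReflectRP
import Summits.QuantumFields.YangMills.Theorems.ParabolicTrajectoryLatticeGapOnTrajectoryTransferHankelSiteStrict
import Summits.QuantumFields.YangMills.Theorems.LatticeGapOnTrajectory.Negative.ZeroCoupling
import HarnessLib

/-!
# Crux `LatticeGapOnTrajectory` (stmt-QuantumFields-10523): the conclusion of `stub_stepScaling` is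
# reachable at zero coupling (sanity lemma `stepScalingConcl_of_zero_coupling`, line
# `step-scaling-contraction`, served slug `StepScalingSketch`)

Helper file (`--supports stmt-QuantumFields-10523`), a junk audit of the currency of the registered physics
stub `stub_stepScaling` of the skeleton `Cruxes/LatticeGapOnTrajectory/Lines/step_scaling_contraction.lean`:
its conclusion `∃ law μ J, 0 < μ ∧ TunedBoxGap … ∧ UniformStepScaling …` HOLDS in the degenerate regime
`β_k = 0` for all `k` (where the crux hypotheses `β_k → ∞` and the tuning fail), so the currency
(`TorusGapAt` / `fvGap` / `zeta` / `StepLaw` of `…StepScalingDefs`) is not junk-contradictory and `StepLaw` is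
inhabited. G-blind bookkeeping; nothing about mass gaps is asserted.

* §1 `osCorr_negReflect_timeShift_eq_zero_of_zero_coupling`: at `β = 0` (product Haar measure,
  `Negative.wilsonMeasure_zero_coupling`) the reflected, translated autocorrelation
  `osCorr μ Θ₀ τ_n X X` of a slab-`1…w` observable VANISHES as soon as `n + 2w + 2 ≤ S_d` (the supports of
  `X ∘ Θ₀` and `X ∘ τ_n` are disjoint; ultralocality
  `Transfer.ZeroCouplingUSC.integral_mul_eq_of_dependsOn_disjoint_complex`).
* §2 `torusGapAt_zero_coupling`: `TorusGapAt ρ 0 S 1 (exp 1)` — for `n + 2w < 2S` the left side vanishes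
  and the right side is `≥ 0` (`osVar ≥ 0` by site reflection positivity, `stub_negReflectRP`); for the
  wrap-around separations `n + 2w ∈ {2S, 2S+1}` the thermal slack is `≥ e · B² · e⁻¹ = B² ≥ ‖osCorr‖`
  (`norm_osCorr_negReflect_timeShift_le_sq`). Hence `fvGap ρ 0 S (exp 1) = 1` and
  `zeta ρ 0 S (exp 1) = 2S + 1` (`fvGap_zero_coupling`, `zeta_zero_coupling`).
* §3 the registered sanity lemma `stepScalingConcl_of_zero_coupling`, with the law
  `Φ ζ = max (2ζ − 1) (ζ + 1)`, `λ = 1`, `κ = e`, `C = 1`, `ζ₁ = 0` (so `StepLaw` is inhabited), `μ = 1`,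
  `J = 0` (`M ≥ 2` by `Negative.two_le_of_shape`, so every box `S ≥ M^{n_k}` has `S ≥ 1` and
  `Φ (2S+1) = 4S+1 = ζ(2S)`).

References: Osterwalder–Seiler, Ann. Phys. 110 (1978) 440, §2; Glimm–Jaffe, Quantum Physics (1987),
§6.1, §19.7; Lüscher–Weisz–Wolff, Nucl. Phys. B 359 (1991) 221, §2.
-/

open scoped ComplexConjugate Topology
open Filter MeasureTheory
open Literature.MathematicalPhysics.QuantumLattice Literature.MathematicalPhysics.QuantumFieldTheory
open Summit.QuantumFields.YangMills.Theses.ParabolicTrajectory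
open Summit.QuantumFields.YangMills.Cruxes.LatticeGapOnTrajectory.OrbitKantorovichFiniteSize

noncomputable section

namespace Summit.QuantumFields.YangMills.Cruxes.LatticeGapOnTrajectory.StepScaling

variable {G : Type} [Group G] [TopologicalSpace G] [IsTopologicalGroup G] [CompactSpace G]
  [MeasurableSpace G] [BorelSpace G] {N : ℕ}

/-! ## §1 Zero coupling: the reflected, translated slab autocorrelation vanishes -/

/-- **Ultralocality at zero coupling.** At `β = 0` Wilson's torus measure is the product Haar measure
(`Negative.wilsonMeasure_zero_coupling`); for a bounded measurable `X` depending only on the links based at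
lattice times `1 … w`, the reflected observable `X ∘ Θ₀` lives on the links based at times `≥ S_d − w − 1`
(`Transfer.ZeroCouplingUSC.dependsOn_comp_negReflect_slab`) and the translate `X ∘ τ_n` on those based at
times `n+1 … n+w` (`Transfer.Hankel.dependsOn_comp_torusTimeShift`); for `n + 2w + 2 ≤ S_d` the two supports
are disjoint, so `∫ conj X(Θ₀U) X(τ_n U) dμ = conj(∫X) ∫X` (ultralocality and the `Θ₀`-, `τ_n`-invariance of
`μ`), i.e. `osCorr μ Θ₀ τ_n X X = 0`. -/
theorem osCorr_negReflect_timeShift_eq_zero_of_zero_coupling {ρ : G →* Matrix (Fin N) (Fin N) ℂ}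
    (hρ : Continuous ρ) {Sd : ℕ} [NeZero Sd] {w n : ℕ} {X : GaugeConfig 4 Sd G → ℂ} (hX : Measurable X)
    {B : ℝ} (hB : ∀ U, ‖X U‖ ≤ B)
    (hXd : DependsOn X {e : Edge 4 Sd | 1 ≤ (e.1 0).val ∧ (e.1 0).val ≤ w}) (hn : n + 2 * w + 2 ≤ Sd) :
    osCorr (wilsonMeasure (d := 4) (L := Sd) ρ 0) GaugeConfig.negReflect (torusTimeShift Sd n) X X = 0 := by
  -- adapted from `Transfer.ZeroCouplingUSC.uniformSlabClustering_of_zero_coupling` (finer separation)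
  set μ : Measure (GaugeConfig 4 Sd G) := wilsonMeasure (d := 4) (L := Sd) ρ 0 with hμ
  haveI := isProbabilityMeasure_wilsonMeasure (d := 4) (L := Sd) ρ hρ 0
  have hpi : μ = Measure.pi fun _ : Edge 4 Sd => haarProbability G := by
    rw [hμ]
    exact Summit.QuantumFields.YangMills.Theorems.LatticeGapOnTrajectory.Negative.wilsonMeasure_zero_coupling
      ρ Sd
  -- supports
  have hXΘ : DependsOn (fun U => conj (X (GaugeConfig.negReflect U)))
      (↑(Finset.univ.filter fun e : Edge 4 Sd => Sd - w - 1 ≤ (e.1 0).val) : Set (Edge 4 Sd)) := by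
    have h := Transfer.ZeroCouplingUSC.dependsOn_comp_negReflect_slab hXd (by omega)
    intro U V hUV
    exact congrArg _ (h (fun e he => hUV e (by simpa using he)))
  have hXτ : DependsOn (fun U => X (torusTimeShift Sd n U))
      (↑(Finset.univ.filter fun e : Edge 4 Sd => 1 + n ≤ (e.1 0).val ∧ (e.1 0).val ≤ w + n) :
        Set (Edge 4 Sd)) := by
    have h := Transfer.Hankel.dependsOn_comp_torusTimeShift hXd n (by omega)
    intro U V hUV
    exact h (fun e he => hUV e (by simpa using he))
  have hdisj : Disjoint (Finset.univ.filter fun e : Edge 4 Sd => Sd - w - 1 ≤ (e.1 0).val)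
      (Finset.univ.filter fun e : Edge 4 Sd => 1 + n ≤ (e.1 0).val ∧ (e.1 0).val ≤ w + n) := by
    rw [Finset.disjoint_filter]
    intro e _ h1 h2
    omega
  -- ultralocality
  have hΘm : Measurable fun U : GaugeConfig 4 Sd G => conj (X U.negReflect) :=
    Complex.continuous_conj.measurable.comp (hX.comp WilsonSiteRP.measurable_negReflect)
  have hτm : Measurable fun U => X (torusTimeShift Sd n U) := hX.comp (torusTimeShift _ _).measurable
  have hfact : ∫ U, conj (X U.negReflect) * X (torusTimeShift Sd n U) ∂μ =
      (∫ U, conj (X U.negReflect) ∂μ) * ∫ U, X (torusTimeShift Sd n U) ∂μ := by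
    rw [hpi]
    exact Transfer.ZeroCouplingUSC.integral_mul_eq_of_dependsOn_disjoint_complex (haarProbability G) _ _
      hdisj hXΘ hXτ hΘm hτm ⟨B, fun U => by rw [RCLike.norm_conj]; exact hB _⟩ ⟨B, fun U => hB _⟩
  -- invariances of the measure
  have hΘint : ∫ U, conj (X U.negReflect) ∂μ = conj (∫ U, X U ∂μ) := by
    rw [integral_conj]
    exact congrArg _ (integral_comp_negReflect_eq ρ hρ 0 X)
  have hτint : ∫ U, X (torusTimeShift Sd n U) ∂μ = ∫ U, X U ∂μ := by
    have hmp : MeasurePreserving (⇑(torusTimeShift (G := G) Sd n)) μ μ :=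
      ⟨(torusTimeShift _ _).measurable, by
        unfold torusTimeShift; exact wilsonMeasure_map_torusConfigShift ρ 0 _⟩
    exact hmp.integral_comp' (f := torusTimeShift Sd n) X
  unfold osCorr
  rw [hfact, hΘint, hτint, sub_self]

/-! ## §2 Zero coupling: `TorusGapAt ρ 0 S 1 e`, `fvGap = 1`, `ζ = 2S+1` -/

/-- **The finite-volume OS gap statement at zero coupling, rate `1`, thermal constant `e`.** Given a slab
observable (`w < S`, so `S ≥ 1`) and a separation `n` with `n + 2w ≤ 2S+1`: `0 ≤ osVar μ Θ₀ X` by site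
reflection positivity at `β = 0` (`stub_negReflectRP`, in the OS-variance form
`HankelSite.osVar_negReflect_nonneg_of_rp_lt`); if `n + 2w < 2S` the autocorrelation vanishes
(`osCorr_negReflect_timeShift_eq_zero_of_zero_coupling`); otherwise `2S+1−n−2w ≤ 1`, the thermal slack is
`≥ e B² e^{−1} = B² ≥ ‖osCorr‖` (`norm_osCorr_negReflect_timeShift_le_sq`). -/
theorem torusGapAt_zero_coupling {ρ : G →* Matrix (Fin N) (Fin N) ℂ} (hρ : Continuous ρ) (S : ℕ) :
    TorusGapAt ρ 0 S 1 (Real.exp 1) := by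
  intro w n X B hX hB hdep hw hn
  have hS : 1 ≤ S := by omega
  set ν := wilsonMeasure (d := 4) (L := 2 * S + 1) (G := G) ρ 0 with hν
  have hV : 0 ≤ osVar ν GaugeConfig.negReflect X :=
    Transfer.HankelSite.osVar_negReflect_nonneg_of_rp_lt ρ hρ 0 (stub_negReflectRP ρ hρ le_rfl hS)
      hX ⟨B, hB⟩ hw hdep
  have hV' : 0 ≤ osVar ν GaugeConfig.negReflect X * Real.exp (-(1 * (n : ℝ))) :=
    mul_nonneg hV (Real.exp_pos _).le
  have hth0 : 0 ≤ Real.exp 1 * B ^ 2 * Real.exp (-(1 * ((2 * S + 1 : ℝ) - n - 2 * w))) := by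
    positivity
  rcases Nat.lt_or_ge (n + 2 * w) (2 * S) with hlt | hge
  · -- disjoint supports: the autocorrelation vanishes
    have h0 : osCorr ν GaugeConfig.negReflect (torusTimeShift (2 * S + 1) n) X X = 0 :=
      osCorr_negReflect_timeShift_eq_zero_of_zero_coupling hρ hX hB hdep (by omega)
    rw [h0, norm_zero]
    exact add_nonneg hV' hth0
  · -- wrap-around separations: the thermal slack dominates the covariance bound
    have hC : ‖osCorr ν GaugeConfig.negReflect (torusTimeShift (2 * S + 1) n) X X‖ ≤ B ^ 2 :=
      norm_osCorr_negReflect_timeShift_le_sq hρ 0 n hX hB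
    have hexp : Real.exp (-1) ≤ Real.exp (-(1 * ((2 * S + 1 : ℝ) - n - 2 * w))) := by
      rw [Real.exp_le_exp]
      have h1 : ((2 * S : ℕ) : ℝ) ≤ ((n + 2 * w : ℕ) : ℝ) := by exact_mod_cast hge
      push_cast at h1
      linarith
    have hth : B ^ 2 ≤ Real.exp 1 * B ^ 2 * Real.exp (-(1 * ((2 * S + 1 : ℝ) - n - 2 * w))) := by
      calc B ^ 2 = Real.exp 1 * B ^ 2 * Real.exp (-1) := by
            rw [mul_right_comm, ← Real.exp_add, add_neg_cancel, Real.exp_zero, one_mul]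
        _ ≤ Real.exp 1 * B ^ 2 * Real.exp (-(1 * ((2 * S + 1 : ℝ) - n - 2 * w))) :=
            mul_le_mul_of_nonneg_left hexp (by positivity)
    linarith

/-- **The finite-volume gap at zero coupling is the cap**: `fvGap ρ 0 S (exp 1) = 1` (the rate `1` belongs to
the set `{m | 0 ≤ m ≤ 1, TorusGapAt ρ 0 S m e}`, `torusGapAt_zero_coupling`, which is bounded above by `1`). -/
theorem fvGap_zero_coupling {ρ : G →* Matrix (Fin N) (Fin N) ℂ} (hρ : Continuous ρ) (S : ℕ) :
    fvGap ρ 0 S (Real.exp 1) = 1 := by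
  unfold fvGap
  have hbdd : BddAbove {m : ℝ | 0 ≤ m ∧ m ≤ 1 ∧ TorusGapAt ρ 0 S m (Real.exp 1)} :=
    ⟨1, fun m hm => hm.2.1⟩
  have hmem : (1 : ℝ) ∈ {m : ℝ | 0 ≤ m ∧ m ≤ 1 ∧ TorusGapAt ρ 0 S m (Real.exp 1)} :=
    ⟨zero_le_one, le_rfl, torusGapAt_zero_coupling hρ S⟩
  exact le_antisymm (csSup_le ⟨1, hmem⟩ fun m hm => hm.2.1) (le_csSup hbdd hmem)

/-- **The step-scaling variable at zero coupling is the box side**: `zeta ρ 0 S (exp 1) = 2S + 1`. -/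
theorem zeta_zero_coupling {ρ : G →* Matrix (Fin N) (Fin N) ℂ} (hρ : Continuous ρ) (S : ℕ) :
    zeta ρ 0 S (Real.exp 1) = 2 * S + 1 := by
  unfold zeta
  rw [fvGap_zero_coupling hρ S, mul_one]

/-! ## §3 The sanity lemma -/

/-- **stepScalingConcl_of_zero_coupling** (registered G-blind sanity lemma of the line
`step-scaling-contraction`, signature verbatim) — THE CONCLUSION OF `stub_stepScaling` IS REACHABLE AT ZERO
COUPLING: for every `M`-adic scheme with `β_k = 0` for all `k`, the volume-doubling law
`Φ ζ = max (2ζ − 1) (ζ + 1)` (continuous, `ζ < ζ + 1 ≤ Φ ζ`, `2ζ − 1 ≤ Φ ζ`), `λ = 1`, `κ = e`, `C = 1`,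
`ζ₁ = 0` — so the structure `StepLaw` is inhabited — together with `μ = 1` and `J = 0` satisfies `0 < μ`,
`TunedBoxGap r sch (fun k => 2^0 · M^{n_k}) e 1` and `UniformStepScaling r sch (fun k => 2^0 · M^{n_k}) law`:
at `β = 0` one has `ζ(S) = 2S+1` for every `S` (`zeta_zero_coupling`), so `1 ≤ ζ(D_k)`; `M ≥ 2`
(`Negative.two_le_of_shape`) gives `D_k ≥ 1`, and for `S ≥ 1`, `Φ(2S+1) = max (4S+1) (2S+2) = 4S+1 = ζ(2S)`
and `ζ(S) = 2S+1 ≤ 2S'+1 = ζ(S')` for `S ≤ S'`. Hence the currency of the physics stub is not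
junk-contradictory (its hypotheses `β_k → ∞` and the tuning fail here). -/
theorem stepScalingConcl_of_zero_coupling :
    ∀ (G : Type) [Group G] [TopologicalSpace G] [IsTopologicalGroup G] [CompactSpace G]
      [MeasurableSpace G] [BorelSpace G] (r : LatticeRep G) (M : ℕ) (sch : SpeciesScheme (YMSpecies G))
      (n : ℕ → ℕ), (∀ k, sch.a k = ((M : ℝ) ^ n k)⁻¹) → (∀ k, sch.β k = 0) →
        ∃ (law : StepLaw) (μ : ℝ) (J : ℕ), 0 < μ ∧ TunedBoxGap r sch (fun k => 2 ^ J * M ^ n k) law.κ μ ∧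
          UniformStepScaling r sch (fun k => 2 ^ J * M ^ n k) law := by
  intro G _ _ _ _ _ _ r M sch n hshape hβ
  have hM : 2 ≤ M :=
    Summit.QuantumFields.YangMills.Theorems.LatticeGapOnTrajectory.Negative.two_le_of_shape sch hshape
  refine ⟨{ Φ := fun ζ => max (2 * ζ - 1) (ζ + 1), lam := 1, κ := Real.exp 1, C := 1, ζ₁ := 0,
            continuous := ((continuous_const.mul continuous_id).sub continuous_const).max
              (continuous_id.add continuous_const),
            lt_map := fun ζ _ => (lt_add_one ζ).trans_le (le_max_right _ _),
            two_mul_sub_le := fun _ _ => le_max_left _ _,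
            lam_pos := one_pos,
            lam_le_one := le_rfl }, 1, 0, one_pos, ?_, ?_⟩
  · -- the anchor: `1 ≤ ζ(D_k) = 2 D_k + 1`
    refine Eventually.of_forall fun k => ?_
    dsimp only
    rw [hβ k, zeta_zero_coupling r.continuous]
    have : (0 : ℝ) ≤ ((2 ^ 0 * M ^ n k : ℕ) : ℝ) := Nat.cast_nonneg _
    linarith
  · -- the law: `Φ(2S+1) = 4S+1 = ζ(2S)` and `ζ(S) ≤ ζ(S')` for `1 ≤ S ≤ S'`
    refine Eventually.of_forall fun k S hS => ?_
    have hD : 1 ≤ 2 ^ 0 * M ^ n k := by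
      simpa using Nat.one_le_pow (n k) M (by omega)
    have hS1 : (1 : ℝ) ≤ S := by exact_mod_cast hD.trans hS
    dsimp only
    simp only [hβ k, zeta_zero_coupling r.continuous, one_mul]
    refine ⟨?_, fun S' h1 _ => ?_⟩
    · rw [max_le_iff]
      constructor
      · push_cast; linarith
      · push_cast; linarith
    · have : (S : ℝ) ≤ S' := by exact_mod_cast h1
      linarith

end Summit.QuantumFields.YangMills.Cruxes.LatticeGapOnTrajectory.StepScaling

end
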